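import Summits.Ventures.YMGap.YM3IR.CovariantFamily
import Summits.Ventures.YMGap.YM3IR.InMean
import Summits.Ventures.YMGap.RobustBall.AreaLawRadius
import Summits.Ventures.YMGap.RobustBall.RobustAreaLawBallW
import Summits.Ventures.YMGap.RobustBall.RobustAreaLawVertexW
import HarnessLib

/-!
# YM3IR / BallMonotone — the Y4 hypotheses are MONOTONE in the receiving ball: how two rows of the §Y4 table compare
(theorems only; no new conjecture name, no `def`)

HONEST FRAMING (cell pub-ymgap, track Y4 / YM3-IR, seat ym3ir-theory-1, gen 12).  This file claims NO summit, NO mass gap and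
NO part of Bałaban's theorems; it adds NO definition, NO conjecture, NO axiom, NO `sorry`; `0` compute.  It is kernel-checked
BOOKKEEPING answering ONE reading question about the table of §Y4 sentences (one sentence per certified receiving ball of track
Y2: `YM3IR/BalabanCeilings*.lean`, `YM3IR/BalabanSU2.lean`, `YM3IR/BalabanSU3.lean`, `YM3IR/BalabanSUN.lean`): WHEN DOES ONE ROW
IMPLY ANOTHER?  LABEL OF RECORD (R196, verbatim): a typed INTERFACE / dictionary, NOT a reduction — with existential `(C_b, κ)`
the free-family conjecture is target-equivalent on every receiving ball in the tree (theory-2, `YM3IR/ForestWitness.lean`,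
`YM3IR/ForestWitnessSUN.lean`: the forest witness enters any ball containing product Haar,
`ForestWitnessSUN.forestWitness3_of_piHaarMem`); the covariant form `IRConjecture3Cov` (`YM3IR/CovariantFamily.lean`) is a
genuine sufficient condition, possibly strictly stronger, converse NOT known — never "the remaining gap".

THE ORDER (spelled out as three hypotheses; no new definition).  `B₁ ≼ B₂` for two ball specs `B₁ B₂ : BallSpec G N` means:
the same Wilson representation (`B₂.ρ = B₁.ρ`), a Wilson-part ceiling at most as large (`B₁.βstar ≤ B₂.βstar`), and
`B₁.InBall M W → B₂.InBall M W` for every torus side `M` and every perturbation `W`.  Then, all by one-line proofs: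
* MEMBERSHIP is monotone (`BallSpec.Mem.mono`), hence every hypothesis of the `T_IR` family that asks the blocked laws to ENTER the
  ball gets WEAKER as the ball grows: `EntersClusterDomain`, `Crossover3`, `T_IR`, `T_IRInMean`, `IRConjecture3`,
  `IRConjecture3InMean`, `IRConjecture3Cov` (`*_mono`);
* track Y2's deliverable `ClusterDomainClustering B r m_c` (clustering OF EVERY member) gets STRONGER as the ball grows
  (`clusterDomainClustering_anti`);
* so the §Y4 sentence `IRConjecture3Cov B₂ … → P` on the BIGGER ball implies the sentence `IRConjecture3Cov B₁ … → P` on the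
  smaller one at the same `(r, ρ, I, C_b, κ)` (`sentence_cov_of_le`, `sentence_of_le`, `sentence_inMean_of_le`): among rows with
  NESTED balls only the largest ball carries information; rows whose balls are INCOMPARABLE — a higher Wilson ceiling `β⋆` bought
  with smaller radii `(ε₀, ε₁)`, the `rhoFR`-budget trade-off of Y2's certificates — are genuinely different sentences, none implied
  by another through this order.  For the FREE form `IRConjecture3` the comparison is moot: on every ball containing product Haar
  it is target-equivalent (`ForestWitnessSUN.irConjecture3_iff_massGap3Cofinal_of_piHaarMem`, theory-2).
* every clause predicate is `∀ β ∈ I, …`, so every hypothesis is also ANTITONE in the coupling set (`*_anti_set`): the conjecture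
  on `Set.Ici β₁` implies it on any sub-family of couplings (e.g. Bałaban's `L^{-k}` spacings).
CONCRETE NESTINGS (track Y2's balls, tree lemmas BY NAME).  Tier 1 `ballOfRobustBallFR N ε₀ ε₁ r β⋆` grows with the radii
(`RobustBall.clusterDomainFR_mono`), with the range `r` (`RobustBall.clusterDomainFR_mono_range`) and with `β⋆`
(`inBall_ballOfRobustBallFR_mono`, `irConjecture3Cov_ballFR_mono`, `clusterDomainClustering_ballFR_anti`); tier 2
`ballOfRobustBall N κ ε₀ ε₁ β⋆` grows with `ε₀, ε₁, β⋆` and SHRINKS with the weight `κ` (`RobustBall.clusterDomain_mono`;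
`inBall_ballOfRobustBall_mono`, `irConjecture3Cov_ball_mono`, `clusterDomainClustering_ball_anti`); tier 2 CONTAINS tier 1 once
the radii are inflated by `e^{κ r}` (`RobustBall.clusterDomainFR_subset_clusterDomain`; `inBall_ballOfRobustBall_of_ballFR`,
`irConjecture3Cov_ball_of_ballFR`).  TABLE INSTANCES AS TYPED (verbatim ball / ceiling terms of the tree's sentences; only
the ORDER is proved): `irConjecture3Cov_ballFR_free40_to_star40`, `…_su2_star40_to_record`, `…_su2_star32_to_record`,
`…_su2_star24_to_quarter`, `…_su2_W_nineTwentieths_to_oneHalf`, `…_su3_free40_to_starQuarter`, `…_su3_starQuarter_to_star32`,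
`…_su3_star24_to_pvTwoFifths`, `…_su3_pvCeiling_to_certifiedStar`.  Nothing here asserts that any particular ball is certified:
that is track Y2's theorem, row by row.  Lattice statements only; no continuum limit, no Millennium claim.  USE: the partial
order of the §Y4 table is a theorem — bigger certified ball ⇒ weaker covariant conjecture ⇒ stronger sentence — so dominated
rows can be dropped from the paper's table with a kernel-checked reason and incomparable rows are recognisably incomparable.

References: T. Bałaban, CMP 98 (1985) 17–51, (11), (15) p. 19 [cite: Balaban1985Averaging]; CMP 119 (1988) p. 259 (2.25)–(2.28)
(the polymer format of the ball's carrier) [cite: Balaban1988Convergent].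
-/

open MeasureTheory
open Literature.MathematicalPhysics.QuantumLattice Literature.MathematicalPhysics.QuantumFieldTheory

namespace Summit.Ventures.YMGap.YM3IR

/-! ## §0 Two structural clauses are antitone in the coupling set (no topology needed) -/

/-- Gauge covariance along a coupling set holds along every subset. [folklore] -/
theorem BlockFamily.IsGaugeCovariantOn.anti_set {G : Type} [MeasurableSpace G] [Group G] {W : BlockFamily G}
    {I I' : Set ℝ} (hI : I' ⊆ I) (h : W.IsGaugeCovariantOn I) : W.IsGaugeCovariantOn I' :=
  fun β hβ => h β (hI hβ)

/-- Block locality along a coupling set holds along every subset. [folklore] -/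
theorem BlockFamily.IsBlockLocalOn.anti_set {G : Type} [MeasurableSpace G] {W : BlockFamily G} {I I' : Set ℝ}
    (hI : I' ⊆ I) (h : W.IsBlockLocalOn I) : W.IsBlockLocalOn I' :=
  fun β hβ => h β (hI hβ)

/-! ## §1 The abstract order on ball specs: membership and the hypotheses are monotone, Y2's deliverable is antitone -/

section Abstract

variable {G : Type} [MeasurableSpace G] {N : ℕ} [Group G] [TopologicalSpace G] [IsTopologicalGroup G]
  [CompactSpace G] [BorelSpace G]

/-- **Membership is monotone in the ball spec** (`B₁ ≼ B₂`: same representation, `β⋆₁ ≤ β⋆₂`, `InBall₁ ⊆ InBall₂`). [folklore] -/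
theorem BallSpec.Mem.mono {B₁ B₂ : BallSpec G N} (hρ : B₂.ρ = B₁.ρ) (hβ : B₁.βstar ≤ B₂.βstar)
    (hIn : ∀ (M : ℕ) [NeZero M] (W : QuasiLocalGaugePerturbation 3 M G 1), B₁.InBall M W → B₂.InBall M W)
    {M : ℕ} [NeZero M] {μ : Measure (GaugeConfig 3 M G)} (h : B₁.Mem M μ) : B₂.Mem M μ := by
  obtain ⟨β', h0, hle, W, hW, rfl⟩ := h
  exact ⟨β', h0, hle.trans hβ, W, hIn M W hW, by rw [hρ]⟩

/-- **Y2's deliverable is ANTITONE in the ball**: clustering of every member of the bigger ball is clustering of every member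
of the smaller one (same constant, same rate). [folklore] -/
theorem clusterDomainClustering_anti {B₁ B₂ : BallSpec G N} (hρ : B₂.ρ = B₁.ρ) (hβ : B₁.βstar ≤ B₂.βstar)
    (hIn : ∀ (M : ℕ) [NeZero M] (W : QuasiLocalGaugePerturbation 3 M G 1), B₁.InBall M W → B₂.InBall M W)
    {r : G → G → ℝ} {m_c : ℝ} (h : ClusterDomainClustering B₂ r m_c) : ClusterDomainClustering B₁ r m_c := by
  obtain ⟨A, hA⟩ := h
  exact ⟨A, fun M _ hM μ hμ => hA M hM μ (hμ.mono hρ hβ hIn)⟩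

/-- **T_IR(a) is monotone in the ball**: entering the smaller ball is entering the bigger one (same block factor bound). [folklore] -/
theorem entersClusterDomain_mono {B₁ B₂ : BallSpec G N} (hρ : B₂.ρ = B₁.ρ) (hβ : B₁.βstar ≤ B₂.βstar)
    (hIn : ∀ (M : ℕ) [NeZero M] (W : QuasiLocalGaugePerturbation 3 M G 1), B₁.InBall M W → B₂.InBall M W)
    {ρ : G →* Matrix (Fin N) (Fin N) ℂ} {W : BlockFamily G} {I : Set ℝ} {C_b : ℝ}
    (h : EntersClusterDomain B₁ ρ W I C_b) : EntersClusterDomain B₂ ρ W I C_b :=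
  fun β hβI => ⟨(h β hβI).1, fun M _ hM => ((h β hβI).2 M hM).mono hρ hβ hIn⟩

/-- `Crossover3` (the conditional form of T_IR(a)) is monotone in the ball. [folklore] -/
theorem crossover3_mono {B₁ B₂ : BallSpec G N} (hρ : B₂.ρ = B₁.ρ) (hβ : B₁.βstar ≤ B₂.βstar)
    (hIn : ∀ (M : ℕ) [NeZero M] (W : QuasiLocalGaugePerturbation 3 M G 1), B₁.InBall M W → B₂.InBall M W)
    {L : ℕ} {mk : Balaban1985CMP102.Theorems.Construction L} {ρ : G →* Matrix (Fin N) (Fin N) ℂ} {W : BlockFamily G}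
    {I : Set ℝ} {C_b : ℝ} (h : Crossover3 mk B₁ ρ W I C_b) : Crossover3 mk B₂ ρ W I C_b :=
  fun hUV => entersClusterDomain_mono hρ hβ hIn (h hUV)

/-- **`T_IR` is monotone in the ball** (clauses (b), (c) do not mention the ball). [folklore] -/
theorem t_IR_mono {B₁ B₂ : BallSpec G N} (hρ : B₂.ρ = B₁.ρ) (hβ : B₁.βstar ≤ B₂.βstar)
    (hIn : ∀ (M : ℕ) [NeZero M] (W : QuasiLocalGaugePerturbation 3 M G 1), B₁.InBall M W → B₂.InBall M W)
    {L : ℕ} {mk : Balaban1985CMP102.Theorems.Construction L} {r : G → G → ℝ} {ρ : G →* Matrix (Fin N) (Fin N) ℂ}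
    {I : Set ℝ} {C_b κ m_c : ℝ} (h : T_IR mk B₁ r ρ I C_b κ m_c) : T_IR mk B₂ r ρ I C_b κ m_c := by
  obtain ⟨W, ha, hb, hc⟩ := h
  exact ⟨W, crossover3_mono hρ hβ hIn ha, hb, hc⟩

/-- `T_IRInMean` is monotone in the ball. [folklore] -/
theorem t_IRInMean_mono {B₁ B₂ : BallSpec G N} (hρ : B₂.ρ = B₁.ρ) (hβ : B₁.βstar ≤ B₂.βstar)
    (hIn : ∀ (M : ℕ) [NeZero M] (W : QuasiLocalGaugePerturbation 3 M G 1), B₁.InBall M W → B₂.InBall M W)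
    {L : ℕ} {mk : Balaban1985CMP102.Theorems.Construction L} {r : G → G → ℝ} {ρ : G →* Matrix (Fin N) (Fin N) ℂ}
    {I : Set ℝ} {C_b κ : ℝ} (h : T_IRInMean mk B₁ r ρ I C_b κ) : T_IRInMean mk B₂ r ρ I C_b κ := by
  obtain ⟨W, ha, hb⟩ := h
  exact ⟨W, crossover3_mono hρ hβ hIn ha, hb⟩

/-- **The conjecture of record `IRConjecture3` is monotone in the ball** — WEAKER on a bigger ball. [folklore] -/
theorem irConjecture3_mono {B₁ B₂ : BallSpec G N} (hρ : B₂.ρ = B₁.ρ) (hβ : B₁.βstar ≤ B₂.βstar)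
    (hIn : ∀ (M : ℕ) [NeZero M] (W : QuasiLocalGaugePerturbation 3 M G 1), B₁.InBall M W → B₂.InBall M W)
    {r : G → G → ℝ} {ρ : G →* Matrix (Fin N) (Fin N) ℂ} {I : Set ℝ} {C_b κ : ℝ}
    (h : IRConjecture3 B₁ r ρ I C_b κ) : IRConjecture3 B₂ r ρ I C_b κ := by
  obtain ⟨W, ha, hb⟩ := h
  exact ⟨W, entersClusterDomain_mono hρ hβ hIn ha, hb⟩

/-- `IRConjecture3InMean` is monotone in the ball. [folklore] -/
theorem irConjecture3InMean_mono {B₁ B₂ : BallSpec G N} (hρ : B₂.ρ = B₁.ρ) (hβ : B₁.βstar ≤ B₂.βstar)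
    (hIn : ∀ (M : ℕ) [NeZero M] (W : QuasiLocalGaugePerturbation 3 M G 1), B₁.InBall M W → B₂.InBall M W)
    {r : G → G → ℝ} {ρ : G →* Matrix (Fin N) (Fin N) ℂ} {I : Set ℝ} {C_b κ : ℝ}
    (h : IRConjecture3InMean B₁ r ρ I C_b κ) : IRConjecture3InMean B₂ r ρ I C_b κ := by
  obtain ⟨W, ha, hb⟩ := h
  exact ⟨W, entersClusterDomain_mono hρ hβ hIn ha, hb⟩

/-- **The covariant conjecture `IRConjecture3Cov` is monotone in the ball** — WEAKER on a bigger ball (covariance and block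
locality do not mention the ball). [folklore] -/
theorem irConjecture3Cov_mono {B₁ B₂ : BallSpec G N} (hρ : B₂.ρ = B₁.ρ) (hβ : B₁.βstar ≤ B₂.βstar)
    (hIn : ∀ (M : ℕ) [NeZero M] (W : QuasiLocalGaugePerturbation 3 M G 1), B₁.InBall M W → B₂.InBall M W)
    {r : G → G → ℝ} {ρ : G →* Matrix (Fin N) (Fin N) ℂ} {I : Set ℝ} {C_b κ : ℝ}
    (h : IRConjecture3Cov B₁ r ρ I C_b κ) : IRConjecture3Cov B₂ r ρ I C_b κ := by
  obtain ⟨W, hcov, hloc, ha, hb⟩ := h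
  exact ⟨W, hcov, hloc, entersClusterDomain_mono hρ hβ hIn ha, hb⟩

/-- **ROW DOMINANCE, covariant form.** A §Y4 sentence `IRConjecture3Cov B₂ … → P` on the BIGGER ball implies the sentence
on the smaller ball with the same `(r, ρ, I, C_b, κ)` and the same conclusion `P` (in the table: `P = MassGap3Cofinal I r ρ`).
[folklore] -/
theorem sentence_cov_of_le {B₁ B₂ : BallSpec G N} (hρ : B₂.ρ = B₁.ρ) (hβ : B₁.βstar ≤ B₂.βstar)
    (hIn : ∀ (M : ℕ) [NeZero M] (W : QuasiLocalGaugePerturbation 3 M G 1), B₁.InBall M W → B₂.InBall M W)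
    {r : G → G → ℝ} {ρ : G →* Matrix (Fin N) (Fin N) ℂ} {I : Set ℝ} {C_b κ : ℝ} {P : Prop}
    (row : IRConjecture3Cov B₂ r ρ I C_b κ → P) : IRConjecture3Cov B₁ r ρ I C_b κ → P :=
  fun h => row (irConjecture3Cov_mono hρ hβ hIn h)

/-- Row dominance, free form (moot on balls containing product Haar, where the free conjecture is target-equivalent —
`ForestWitnessSUN.irConjecture3_iff_massGap3Cofinal_of_piHaarMem`; recorded for completeness). [folklore] -/
theorem sentence_of_le {B₁ B₂ : BallSpec G N} (hρ : B₂.ρ = B₁.ρ) (hβ : B₁.βstar ≤ B₂.βstar)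
    (hIn : ∀ (M : ℕ) [NeZero M] (W : QuasiLocalGaugePerturbation 3 M G 1), B₁.InBall M W → B₂.InBall M W)
    {r : G → G → ℝ} {ρ : G →* Matrix (Fin N) (Fin N) ℂ} {I : Set ℝ} {C_b κ : ℝ} {P : Prop}
    (row : IRConjecture3 B₂ r ρ I C_b κ → P) : IRConjecture3 B₁ r ρ I C_b κ → P :=
  fun h => row (irConjecture3_mono hρ hβ hIn h)

/-- Row dominance, in-mean form. [folklore] -/
theorem sentence_inMean_of_le {B₁ B₂ : BallSpec G N} (hρ : B₂.ρ = B₁.ρ) (hβ : B₁.βstar ≤ B₂.βstar)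
    (hIn : ∀ (M : ℕ) [NeZero M] (W : QuasiLocalGaugePerturbation 3 M G 1), B₁.InBall M W → B₂.InBall M W)
    {r : G → G → ℝ} {ρ : G →* Matrix (Fin N) (Fin N) ℂ} {I : Set ℝ} {C_b κ : ℝ} {P : Prop}
    (row : IRConjecture3InMean B₂ r ρ I C_b κ → P) : IRConjecture3InMean B₁ r ρ I C_b κ → P :=
  fun h => row (irConjecture3InMean_mono hρ hβ hIn h)

/-- **Y2 on the bigger ball serves the smaller one**: with Y2's input on `B₂` and a composition that needs Y2's input and
the covariant conjecture on the SAME ball `B₁ ≼ B₂`, the composition runs on `B₁` (Y2's input transported by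
`clusterDomainClustering_anti`). [folklore] -/
theorem sentence_cov_of_le_of_y2 {B₁ B₂ : BallSpec G N} (hρ : B₂.ρ = B₁.ρ) (hβ : B₁.βstar ≤ B₂.βstar)
    (hIn : ∀ (M : ℕ) [NeZero M] (W : QuasiLocalGaugePerturbation 3 M G 1), B₁.InBall M W → B₂.InBall M W)
    {r : G → G → ℝ} {ρ : G →* Matrix (Fin N) (Fin N) ℂ} {I : Set ℝ} {C_b κ m_c : ℝ} {P : Prop}
    (comp : ClusterDomainClustering B₁ r m_c → IRConjecture3Cov B₁ r ρ I C_b κ → P)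
    (hY2 : ClusterDomainClustering B₂ r m_c) : IRConjecture3Cov B₁ r ρ I C_b κ → P :=
  comp (clusterDomainClustering_anti hρ hβ hIn hY2)

/-! ### Antitone in the coupling set -/

/-- T_IR(a) on a coupling set holds on every subset. [folklore] -/
theorem entersClusterDomain_anti_set {B : BallSpec G N} {ρ : G →* Matrix (Fin N) (Fin N) ℂ} {W : BlockFamily G}
    {I I' : Set ℝ} (hI : I' ⊆ I) {C_b : ℝ} (h : EntersClusterDomain B ρ W I C_b) : EntersClusterDomain B ρ W I' C_b :=
  fun β hβ => h β (hI hβ)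

/-- T_IR(b) on a coupling set holds on every subset. [folklore] -/
theorem fluctuationDecoupling_anti_set {r : G → G → ℝ} {ρ : G →* Matrix (Fin N) (Fin N) ℂ} {W : BlockFamily G}
    {I I' : Set ℝ} (hI : I' ⊆ I) {κ : ℝ} (h : FluctuationDecoupling r ρ W I κ) : FluctuationDecoupling r ρ W I' κ :=
  fun β hβ => h β (hI hβ)

/-- T_IR(b) in mean on a coupling set holds on every subset. [folklore] -/
theorem fluctuationDecouplingInMean_anti_set {r : G → G → ℝ} {ρ : G →* Matrix (Fin N) (Fin N) ℂ} {W : BlockFamily G}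
    {I I' : Set ℝ} (hI : I' ⊆ I) {κ : ℝ} (h : FluctuationDecouplingInMean r ρ W I κ) :
    FluctuationDecouplingInMean r ρ W I' κ :=
  fun β hβ => h β (hI hβ)

/-- **The conjecture of record on a coupling set implies it on every subset.** [folklore] -/
theorem irConjecture3_anti_set {B : BallSpec G N} {r : G → G → ℝ} {ρ : G →* Matrix (Fin N) (Fin N) ℂ} {I I' : Set ℝ}
    (hI : I' ⊆ I) {C_b κ : ℝ} (h : IRConjecture3 B r ρ I C_b κ) : IRConjecture3 B r ρ I' C_b κ := by
  obtain ⟨W, ha, hb⟩ := h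
  exact ⟨W, entersClusterDomain_anti_set hI ha, fluctuationDecoupling_anti_set hI hb⟩

/-- `IRConjecture3InMean` on a coupling set implies it on every subset. [folklore] -/
theorem irConjecture3InMean_anti_set {B : BallSpec G N} {r : G → G → ℝ} {ρ : G →* Matrix (Fin N) (Fin N) ℂ}
    {I I' : Set ℝ} (hI : I' ⊆ I) {C_b κ : ℝ} (h : IRConjecture3InMean B r ρ I C_b κ) :
    IRConjecture3InMean B r ρ I' C_b κ := by
  obtain ⟨W, ha, hb⟩ := h
  exact ⟨W, entersClusterDomain_anti_set hI ha, fluctuationDecouplingInMean_anti_set hI hb⟩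

/-- **The covariant conjecture on a coupling set implies it on every subset** (e.g. `Set.Ici β₁` ⟹ Bałaban's cofinal
family of couplings). [folklore] -/
theorem irConjecture3Cov_anti_set {B : BallSpec G N} {r : G → G → ℝ} {ρ : G →* Matrix (Fin N) (Fin N) ℂ}
    {I I' : Set ℝ} (hI : I' ⊆ I) {C_b κ : ℝ} (h : IRConjecture3Cov B r ρ I C_b κ) : IRConjecture3Cov B r ρ I' C_b κ := by
  obtain ⟨W, hcov, hloc, ha, hb⟩ := h
  exact ⟨W, hcov.anti_set hI, hloc.anti_set hI, entersClusterDomain_anti_set hI ha, fluctuationDecoupling_anti_set hI hb⟩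

end Abstract

/-! ## §2 Concrete nestings of track Y2's balls (tree lemmas by name) -/

section Concrete
variable {N : ℕ}

/-- **Tier 1 grows with radii, range and ceiling**: `ε₀ ≤ ε₀'`, `ε₁ ≤ ε₁'`, `r ≤ r'` give
`InBall (ballOfRobustBallFR N ε₀ ε₁ r β⋆) ⊆ InBall (ballOfRobustBallFR N ε₀' ε₁' r' β⋆')` (the ceilings play no role in `InBall`;
they enter through `BallSpec.Mem.mono`). [folklore] -/
theorem inBall_ballOfRobustBallFR_mono {ε₀ ε₁ ε₀' ε₁' : ℝ} {r r' : ℕ} (h₀ : ε₀ ≤ ε₀') (h₁ : ε₁ ≤ ε₁') (hr : r ≤ r')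
    (βstar βstar' : ℝ) (M : ℕ) [NeZero M] (W : QuasiLocalGaugePerturbation 3 M (RobustBall.SUN N) 1)
    (hW : (ballOfRobustBallFR N ε₀ ε₁ r βstar).InBall M W) : (ballOfRobustBallFR N ε₀' ε₁' r' βstar').InBall M W :=
  RobustBall.clusterDomainFR_mono_range hr (RobustBall.clusterDomainFR_mono h₀ h₁ hW)

/-- **Tier 2 grows with the radii and shrinks with the weight**: `κ' ≤ κ`, `ε₀ ≤ ε₀'`, `ε₁ ≤ ε₁'` give
`InBall (ballOfRobustBall N κ ε₀ ε₁ β⋆) ⊆ InBall (ballOfRobustBall N κ' ε₀' ε₁' β⋆')`. [folklore] -/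
theorem inBall_ballOfRobustBall_mono {κ κ' ε₀ ε₁ ε₀' ε₁' : ℝ} (hκ : κ' ≤ κ) (h₀ : ε₀ ≤ ε₀') (h₁ : ε₁ ≤ ε₁')
    (βstar βstar' : ℝ) (M : ℕ) [NeZero M] (W : QuasiLocalGaugePerturbation 3 M (RobustBall.SUN N) 1)
    (hW : (ballOfRobustBall N κ ε₀ ε₁ βstar).InBall M W) : (ballOfRobustBall N κ' ε₀' ε₁' βstar').InBall M W :=
  RobustBall.clusterDomain_mono hκ h₀ h₁ hW

/-- **Tier 2 contains tier 1 with inflated radii**: `0 ≤ κ`, `e^{κ r} ε₀ ≤ ε₀'`, `e^{κ r} ε₁ ≤ ε₁'` give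
`InBall (ballOfRobustBallFR N ε₀ ε₁ r β⋆) ⊆ InBall (ballOfRobustBall N κ ε₀' ε₁' β⋆')`. [folklore] -/
theorem inBall_ballOfRobustBall_of_ballFR {κ ε₀ ε₁ ε₀' ε₁' : ℝ} {r : ℕ} (hκ : 0 ≤ κ)
    (h₀ : Real.exp (κ * r) * ε₀ ≤ ε₀') (h₁ : Real.exp (κ * r) * ε₁ ≤ ε₁')
    (βstar βstar' : ℝ) (M : ℕ) [NeZero M] (W : QuasiLocalGaugePerturbation 3 M (RobustBall.SUN N) 1)
    (hW : (ballOfRobustBallFR N ε₀ ε₁ r βstar).InBall M W) : (ballOfRobustBall N κ ε₀' ε₁' βstar').InBall M W :=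
  RobustBall.clusterDomainFR_subset_clusterDomain hκ h₀ h₁ hW

/-- **Covariant conjecture, tier 1: WEAKER on bigger radii / longer range / higher ceiling.** [folklore] -/
theorem irConjecture3Cov_ballFR_mono {ε₀ ε₁ ε₀' ε₁' βstar βstar' : ℝ} {r r' : ℕ} (h₀ : ε₀ ≤ ε₀') (h₁ : ε₁ ≤ ε₁')
    (hr : r ≤ r') (hβ : βstar ≤ βstar') {rG : RobustBall.SUN N → RobustBall.SUN N → ℝ}
    {ρ : RobustBall.SUN N →* Matrix (Fin N) (Fin N) ℂ} {I : Set ℝ} {C_b κ : ℝ}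
    (h : IRConjecture3Cov (ballOfRobustBallFR N ε₀ ε₁ r βstar) rG ρ I C_b κ) :
    IRConjecture3Cov (ballOfRobustBallFR N ε₀' ε₁' r' βstar') rG ρ I C_b κ :=
  irConjecture3Cov_mono (B₁ := ballOfRobustBallFR N ε₀ ε₁ r βstar) (B₂ := ballOfRobustBallFR N ε₀' ε₁' r' βstar') rfl hβ
    (inBall_ballOfRobustBallFR_mono h₀ h₁ hr βstar βstar') h

/-- **Y2's tier-1 deliverable: STRONGER on bigger radii / longer range / higher ceiling** (it transports down). [folklore] -/
theorem clusterDomainClustering_ballFR_anti {ε₀ ε₁ ε₀' ε₁' βstar βstar' : ℝ} {r r' : ℕ} (h₀ : ε₀ ≤ ε₀') (h₁ : ε₁ ≤ ε₁')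
    (hr : r ≤ r') (hβ : βstar ≤ βstar') {rG : RobustBall.SUN N → RobustBall.SUN N → ℝ} {m_c : ℝ}
    (h : ClusterDomainClustering (ballOfRobustBallFR N ε₀' ε₁' r' βstar') rG m_c) :
    ClusterDomainClustering (ballOfRobustBallFR N ε₀ ε₁ r βstar) rG m_c :=
  clusterDomainClustering_anti (B₁ := ballOfRobustBallFR N ε₀ ε₁ r βstar) (B₂ := ballOfRobustBallFR N ε₀' ε₁' r' βstar')
    rfl hβ (inBall_ballOfRobustBallFR_mono h₀ h₁ hr βstar βstar') h

/-- **Covariant conjecture, tier 2: WEAKER on bigger radii / smaller weight / higher ceiling.** [folklore] -/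
theorem irConjecture3Cov_ball_mono {κ κ' ε₀ ε₁ ε₀' ε₁' βstar βstar' : ℝ} (hκ : κ' ≤ κ) (h₀ : ε₀ ≤ ε₀') (h₁ : ε₁ ≤ ε₁')
    (hβ : βstar ≤ βstar') {rG : RobustBall.SUN N → RobustBall.SUN N → ℝ}
    {ρ : RobustBall.SUN N →* Matrix (Fin N) (Fin N) ℂ} {I : Set ℝ} {C_b κf : ℝ}
    (h : IRConjecture3Cov (ballOfRobustBall N κ ε₀ ε₁ βstar) rG ρ I C_b κf) :
    IRConjecture3Cov (ballOfRobustBall N κ' ε₀' ε₁' βstar') rG ρ I C_b κf :=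
  irConjecture3Cov_mono (B₁ := ballOfRobustBall N κ ε₀ ε₁ βstar) (B₂ := ballOfRobustBall N κ' ε₀' ε₁' βstar') rfl hβ
    (inBall_ballOfRobustBall_mono hκ h₀ h₁ βstar βstar') h

/-- **Y2's tier-2 deliverable: STRONGER on bigger radii / smaller weight / higher ceiling.** [folklore] -/
theorem clusterDomainClustering_ball_anti {κ κ' ε₀ ε₁ ε₀' ε₁' βstar βstar' : ℝ} (hκ : κ' ≤ κ) (h₀ : ε₀ ≤ ε₀')
    (h₁ : ε₁ ≤ ε₁') (hβ : βstar ≤ βstar') {rG : RobustBall.SUN N → RobustBall.SUN N → ℝ} {m_c : ℝ}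
    (h : ClusterDomainClustering (ballOfRobustBall N κ' ε₀' ε₁' βstar') rG m_c) :
    ClusterDomainClustering (ballOfRobustBall N κ ε₀ ε₁ βstar) rG m_c :=
  clusterDomainClustering_anti (B₁ := ballOfRobustBall N κ ε₀ ε₁ βstar) (B₂ := ballOfRobustBall N κ' ε₀' ε₁' βstar')
    rfl hβ (inBall_ballOfRobustBall_mono hκ h₀ h₁ βstar βstar') h

/-- **Covariant conjecture: the tier-1 form implies the tier-2 form on the inflated weighted ball** (`0 ≤ κ`,
`e^{κ r} ε₀ ≤ ε₀'`, `e^{κ r} ε₁ ≤ ε₁'`, `β⋆ ≤ β⋆'`). [folklore] -/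
theorem irConjecture3Cov_ball_of_ballFR {κ ε₀ ε₁ ε₀' ε₁' βstar βstar' : ℝ} {r : ℕ} (hκ : 0 ≤ κ)
    (h₀ : Real.exp (κ * r) * ε₀ ≤ ε₀') (h₁ : Real.exp (κ * r) * ε₁ ≤ ε₁') (hβ : βstar ≤ βstar')
    {rG : RobustBall.SUN N → RobustBall.SUN N → ℝ} {ρ : RobustBall.SUN N →* Matrix (Fin N) (Fin N) ℂ} {I : Set ℝ}
    {C_b κf : ℝ} (h : IRConjecture3Cov (ballOfRobustBallFR N ε₀ ε₁ r βstar) rG ρ I C_b κf) :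
    IRConjecture3Cov (ballOfRobustBall N κ ε₀' ε₁' βstar') rG ρ I C_b κf :=
  irConjecture3Cov_mono (B₁ := ballOfRobustBallFR N ε₀ ε₁ r βstar) (B₂ := ballOfRobustBall N κ ε₀' ε₁' βstar') rfl hβ
    (inBall_ballOfRobustBall_of_ballFR hκ h₀ h₁ βstar βstar') h

/-- **Y2's tier-2 deliverable on the inflated weighted ball serves the tier-1 ball.** [folklore] -/
theorem clusterDomainClustering_ballFR_of_ball {κ ε₀ ε₁ ε₀' ε₁' βstar βstar' : ℝ} {r : ℕ} (hκ : 0 ≤ κ)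
    (h₀ : Real.exp (κ * r) * ε₀ ≤ ε₀') (h₁ : Real.exp (κ * r) * ε₁ ≤ ε₁') (hβ : βstar ≤ βstar')
    {rG : RobustBall.SUN N → RobustBall.SUN N → ℝ} {m_c : ℝ}
    (h : ClusterDomainClustering (ballOfRobustBall N κ ε₀' ε₁' βstar') rG m_c) :
    ClusterDomainClustering (ballOfRobustBallFR N ε₀ ε₁ r βstar) rG m_c :=
  clusterDomainClustering_anti (B₁ := ballOfRobustBallFR N ε₀ ε₁ r βstar) (B₂ := ballOfRobustBall N κ ε₀' ε₁' βstar')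
    rfl hβ (inBall_ballOfRobustBall_of_ballFR hκ h₀ h₁ βstar βstar') h

/-! ### Two table instances (radii of rows in the tree; no row is asserted, only the order between the balls) -/

/-- **Instance: p1's every-`N` ball `(87/500, 87/1000)` sits inside ds-2's DOUBLED ball `(42/125, 21/125)` at the same range and
ceiling** (`BalabanCeilings` tier 1, 't Hooft `1/40`, vs `BalabanCeilingsSUNStar` working row `…_star_40`): the covariant
conjecture typed on p1's ball implies the one typed on ds-2's. [folklore] -/
theorem irConjecture3Cov_ballFR_87_500_to_42_125 {βstar : ℝ} {r : ℕ}
    {rG : RobustBall.SUN N → RobustBall.SUN N → ℝ} {ρ : RobustBall.SUN N →* Matrix (Fin N) (Fin N) ℂ} {I : Set ℝ}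
    {C_b κ : ℝ} (h : IRConjecture3Cov (ballOfRobustBallFR N (87 / 500) (87 / 1000) r βstar) rG ρ I C_b κ) :
    IRConjecture3Cov (ballOfRobustBallFR N (42 / 125) (21 / 125) r βstar) rG ρ I C_b κ :=
  irConjecture3Cov_ballFR_mono (by norm_num) (by norm_num) le_rfl le_rfl h

/-- **Instance: at equal radii a higher Wilson ceiling is a bigger ball** — the conjecture typed with ceiling `β⋆` implies the
one typed with any `β⋆' ≥ β⋆` (e.g. 't Hooft `N/40 ≤ N/24` when the radii allow it; they do not in ds-2's rows, whose `1/24` ball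
`(3/50, 3/100)` is SMALLER than the `1/40` ball `(42/125, 21/125)` — incomparable rows). [folklore] -/
theorem irConjecture3Cov_ballFR_ceiling_mono {ε₀ ε₁ βstar βstar' : ℝ} {r : ℕ} (hβ : βstar ≤ βstar')
    {rG : RobustBall.SUN N → RobustBall.SUN N → ℝ} {ρ : RobustBall.SUN N →* Matrix (Fin N) (Fin N) ℂ} {I : Set ℝ}
    {C_b κ : ℝ} (h : IRConjecture3Cov (ballOfRobustBallFR N ε₀ ε₁ r βstar) rG ρ I C_b κ) :
    IRConjecture3Cov (ballOfRobustBallFR N ε₀ ε₁ r βstar') rG ρ I C_b κ :=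
  irConjecture3Cov_ballFR_mono le_rfl le_rfl le_rfl hβ h

/-! ### Instances for the §Y4 table AS TYPED (verbatim ball/ceiling terms of the tree's sentences; only the ORDER is proved) -/

/-- **every `N`, tier 1, verbatim ceilings:** the ball of the every-`N` sentence of record (`BalabanCeilings`, p1's row: `(87/500, 87/1000)`, `β⋆ = N/40`)
sits inside the ball of ds-2's `…_star_40_…` sentence (`(42/125, 21/125)`, `β⋆ = N·(1/40)`). [folklore] -/
theorem irConjecture3Cov_ballFR_free40_to_star40 {r : ℕ} {rG : RobustBall.SUN N → RobustBall.SUN N → ℝ}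
    {ρ : RobustBall.SUN N →* Matrix (Fin N) (Fin N) ℂ} {I : Set ℝ} {C_b κ : ℝ}
    (h : IRConjecture3Cov (ballOfRobustBallFR N (87 / 500) (87 / 1000) r ((N : ℝ) / 40)) rG ρ I C_b κ) :
    IRConjecture3Cov (ballOfRobustBallFR N (42 / 125) (21 / 125) r ((N : ℝ) * (1 / 40))) rG ρ I C_b κ :=
  irConjecture3Cov_ballFR_mono (by norm_num) (by norm_num) le_rfl (le_of_eq (by ring)) h

section SU2
variable {r : ℕ} {rG : RobustBall.SUN 2 → RobustBall.SUN 2 → ℝ} {ρ : RobustBall.SUN 2 →* Matrix (Fin 2) (Fin 2) ℂ}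
  {I : Set ℝ} {C_b κ : ℝ}

/-- **`SU(2)`, tier 1:** the `N = 2` ball of ds-2's `…_star_40_…` sentence (`(42/125, 21/125)`, `β⋆ = 2·(1/40)`) sits inside T29A's ball `(23/50, 23/100)`,
`β⋆ = 1/16` (`BalabanSU2`); with `irConjecture3Cov_ballFR_free40_to_star40` at `N = 2` the same holds for the every-`N` row of record. [folklore] -/
theorem irConjecture3Cov_su2_star40_to_record (h : IRConjecture3Cov (ballOfRobustBallFR 2 (42 / 125) (21 / 125) r ((2 : ℝ) * (1 / 40))) rG ρ I C_b κ) :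
    IRConjecture3Cov (ballOfRobustBallFR 2 (23 / 50) (23 / 100) r (1 / 16)) rG ρ I C_b κ :=
  irConjecture3Cov_ballFR_mono (by norm_num) (by norm_num) le_rfl (by norm_num) h

/-- **`SU(2)`, tier 1:** the `N = 2` ball of ds-2's `…_star_32_…` sentence (`(119/500, 119/1000)`, `β⋆ = 2·(1/32)`) sits inside T29A's ball. [folklore] -/
theorem irConjecture3Cov_su2_star32_to_record (h : IRConjecture3Cov (ballOfRobustBallFR 2 (119 / 500) (119 / 1000) r ((2 : ℝ) * (1 / 32))) rG ρ I C_b κ) :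
    IRConjecture3Cov (ballOfRobustBallFR 2 (23 / 50) (23 / 100) r (1 / 16)) rG ρ I C_b κ :=
  irConjecture3Cov_ballFR_mono (by norm_num) (by norm_num) le_rfl (by norm_num) h

/-- **`SU(2)`, tier 1:** the `N = 2` ball of ds-2's `…_star_24_…` sentence (`(3/50, 3/100)`, `β⋆ = 2·(1/24)`) sits inside the quarter row's ball `(3/25,
3/50)`, `β⋆ = 1/8` (`BalabanSU2`). [folklore] -/
theorem irConjecture3Cov_su2_star24_to_quarter (h : IRConjecture3Cov (ballOfRobustBallFR 2 (3 / 50) (3 / 100) r ((2 : ℝ) * (1 / 24))) rG ρ I C_b κ) :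
    IRConjecture3Cov (ballOfRobustBallFR 2 (3 / 25) (3 / 50) r (1 / 8)) rG ρ I C_b κ :=
  irConjecture3Cov_ballFR_mono (by norm_num) (by norm_num) le_rfl (by norm_num) h

/-- **`SU(2)`, tier 2, at the common weight `κ_b = log(6/5)`:** the working row's ball `(7/250, 7/500)`, `β⋆ = 9/40` sits inside the `β_W = 1/2` row's ball
`(4/125, 2/125)`, `β⋆ = 1/4` (`BalabanCeilingsSU2W`). [folklore] -/
theorem irConjecture3Cov_su2_W_nineTwentieths_to_oneHalf
    (h : IRConjecture3Cov (ballOfRobustBall 2 (Real.log (6 / 5)) (7 / 250) (7 / 500) (9 / 40)) rG ρ I C_b κ) :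
    IRConjecture3Cov (ballOfRobustBall 2 (Real.log (6 / 5)) (4 / 125) (2 / 125) (1 / 4)) rG ρ I C_b κ :=
  irConjecture3Cov_ball_mono le_rfl (by norm_num) (by norm_num) (by norm_num) h

/-- The common weight is admissible for the `κ_b ≥ 1/100` rows: `1/100 ≤ log(6/5)` (from `1 − x⁻¹ ≤ log x`). [folklore] -/
theorem hundredth_le_log_sixFifths : (1 : ℝ) / 100 ≤ Real.log (6 / 5) := by
  have h := Real.one_sub_inv_le_log_of_pos (show (0 : ℝ) < 6 / 5 by norm_num); norm_num at h ⊢; linarith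
end SU2

section SU3
variable {r : ℕ} {rG : RobustBall.SUN 3 → RobustBall.SUN 3 → ℝ} {ρ : RobustBall.SUN 3 →* Matrix (Fin 3) (Fin 3) ℂ}
  {I : Set ℝ} {C_b κ : ℝ}

/-- **`SU(3)`, tier 1:** the `N = 3` ball of the every-`N` sentence of record (`(87/500, 87/1000)`, `β⋆ = 3/40`) sits inside the robust-star `β_W = 1/4` ball
`(53/250, 53/500)`, `β⋆ = 1/12` (`BalabanCeilingsSU3`). [folklore] -/
theorem irConjecture3Cov_su3_free40_to_starQuarter (h : IRConjecture3Cov (ballOfRobustBallFR 3 (87 / 500) (87 / 1000) r ((3 : ℝ) / 40)) rG ρ I C_b κ) :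
    IRConjecture3Cov (ballOfRobustBallFR 3 (53 / 250) (53 / 500) r (1 / 12)) rG ρ I C_b κ :=
  irConjecture3Cov_ballFR_mono (by norm_num) (by norm_num) le_rfl (by norm_num) h

/-- **`SU(3)`, tier 1 — an every-`N` row that DOES add a receiving end for `SU(3)` in the ball order:** the robust-star `β_W = 1/4` ball `(53/250, 53/500)`,
`β⋆ = 1/12` sits inside the `N = 3` ball of ds-2's `…_star_32_…` sentence (`(119/500, 119/1000)`, `β⋆ = 3·(1/32)`, Wilson `9/32 > 1/4`). [folklore] -/
theorem irConjecture3Cov_su3_starQuarter_to_star32 (h : IRConjecture3Cov (ballOfRobustBallFR 3 (53 / 250) (53 / 500) r (1 / 12)) rG ρ I C_b κ) :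
    IRConjecture3Cov (ballOfRobustBallFR 3 (119 / 500) (119 / 1000) r ((3 : ℝ) * (1 / 32))) rG ρ I C_b κ :=
  irConjecture3Cov_ballFR_mono (by norm_num) (by norm_num) le_rfl (by norm_num) h

/-- **`SU(3)`, tier 1:** the `N = 3` ball of ds-2's `…_star_24_…` sentence (`(3/50, 3/100)`, `β⋆ = 3·(1/24)`) sits inside engine-2's PV-star `β_W = 2/5` ball
`(2/25, 1/25)`, `β⋆ = 2/15` (`BalabanCeilingsSU3PV`). [folklore] -/
theorem irConjecture3Cov_su3_star24_to_pvTwoFifths (h : IRConjecture3Cov (ballOfRobustBallFR 3 (3 / 50) (3 / 100) r ((3 : ℝ) * (1 / 24))) rG ρ I C_b κ) :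
    IRConjecture3Cov (ballOfRobustBallFR 3 (2 / 25) (1 / 25) r (2 / 15)) rG ρ I C_b κ :=
  irConjecture3Cov_ballFR_mono (by norm_num) (by norm_num) le_rfl (by norm_num) h

/-- **`SU(3)`, tier 1, across the hypothesis-free / GIVEN-H1/H2 divide:** the hypothesis-free PV-star ceiling ball `(3/500, 3/1000)`, `β⋆ = 4/25` sits inside
the certified-star ball `(11/500, 11/1000)`, `β⋆ = 11/40` of the sentence GIVEN H1/H2 (`BalabanCeilingsSU3Certified`) — dominance modulo the extra hypotheses,
not a reason to drop the hypothesis-free row. [folklore] -/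
theorem irConjecture3Cov_su3_pvCeiling_to_certifiedStar (h : IRConjecture3Cov (ballOfRobustBallFR 3 (3 / 500) (3 / 1000) r (4 / 25)) rG ρ I C_b κ) :
    IRConjecture3Cov (ballOfRobustBallFR 3 (11 / 500) (11 / 1000) r (11 / 40)) rG ρ I C_b κ :=
  irConjecture3Cov_ballFR_mono (by norm_num) (by norm_num) le_rfl (by norm_num) h
end SU3

end Concrete
end Summit.Ventures.YMGap.YM3IR
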